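import Literature.AlgebraicGeometry.Resolution.HypersurfaceHeightTwoWeightedCentre
import Literature.AlgebraicGeometry.Resolution.BlowupRestrictOpen
import Literature.AlgebraicGeometry.Resolution.StalkIdealLemmas
import HarnessLib

/-!
# AQS height two, (o25-γ3-T): the `V := ⊤` wrapper — from the on-scheme package to the named fact

Topic: `Summits/ResolutionOfSingularities/ResolutionOfSingularities/Theorems`. Helper for the door item
`HypersurfaceCentreConstruction` (statement `stmt-ResolutionOfSingularities-19897`, route `WeightedInvariant`), ORDER (o25)
«F-AQS-T in the kernel» of `res-L1-w43-plan-1` (lead res-type-092, target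
`AbramovichQuekSchober2025_heightTwoCentre_holds`).  res-type-070, the «open-subscheme transport» that res-type-047 handed back
(STATUS 2026-08-27T10:25:13Z: naive transport along `V.toScheme` stalk coercions times out) done ONCE, def-free.

[OURS · L1 W4.3] Replaces the role of NO printed item; NOT a statement of the manuscript
[claim: Hironaka2017, status: under-review]. AI work, weaker than expert review.  Nothing here asserts the cited fact: the file
proves an implication «package on `Y` ⇒ fact».

## Content

The named fact `AbramovichQuekSchober2025_heightTwoCentre` (`Literature/…/HypersurfaceHeightTwoWeightedCentre.lean`) asks, for
every `(k, Y, f, X, η)` with the five stalk hypotheses, for an OPEN `V ∋ η` of `Y` carrying the Rees algebra, the chart, the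
lex-maximal germ, the order identity, the support clause and the order drop — all spelled on the open subscheme `V`.  The (o25)
assembly produces these data ON `Y` ITSELF (res-type-092's TEAM RECONCILIATION (I3): «output ON `Y` (no `V`) the tuple …; I take
`V := ⊤`»).  This file is the last step:

* `heightTwoCentre_of_onScheme` — if the `V`-free package holds for EVERY `(k, Y, f, X, η)`, the fact holds.  PROOF: given
  `(k, Y, f, X, η)`, apply the package to `Y′ := (⊤ : Y.Opens)` (as a scheme), `f′ := (⊤).ι ≫ f`, `X′ := X|_{Y′}`, `η′ := ⟨η, _⟩`;
  its output IS the fact's `∃ V …` witness with `V = ⊤` LITERALLY (the Rees algebra, chart, germ functions, lex-max predicate and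
  support clause are already spelled on `V`), so no transport of `IsLexMaxWeightedCentreGerm` is needed; only the five hypotheses
  travel along the stalk isomorphism `𝒪_{Y,η} ≅ 𝒪_{Y′,η′}` of the open immersion, and the two occurrences of `idealOrder X′ η′` are
  `idealOrder X η` by `idealOrder_comap_of_isOpenImmersion` (BGMW 8.0.3 (2), tree).
* transport lemmas for a GENERAL open immersion `ι : Y′ ⟶ Y` at `η′` (instantiated at `(⊤).ι` only in the last proof, where
  `(⊤).ι ⟨η, _⟩ = η` holds by `rfl`): `isRegularLocalRing_stalk_of_isOpenImmersion`, `ringKrullDim_stalk_of_isOpenImmersion`,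
  `isPrincipal_stalkIdeal_comap`, `stalkIdeal_comap_ne_bot`, `stalkIdeal_comap_ne_span_pow`.

## References

* D. Abramovich, M. H. Quek, B. Schober, arXiv:2507.01232v3, Thm 1.3 (1),(3), §4 p. 9 L70 («this local construction becomes global
  by setting `𝓘ₙ = 𝒪_S` away from `q`»). [AbramovichQuekSchober2025]
* E. Bierstone, D. Grigoriev, P. Milman, J. Włodarczyk, *Effective Hironaka resolution…*, Lemma 8.0.3 (2). [BierstoneGrigorievMilmanWlodarczyk2011]
-/

noncomputable section

open CategoryTheory AlgebraicGeometry TopologicalSpace IsLocalRing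
open Literature.AlgebraicGeometry.Resolution

set_option linter.dupNamespace false -- mandated namespace of this single-conjunct summit

namespace Summit.ResolutionOfSingularities.ResolutionOfSingularities.Theorems

namespace AQSHeightTwo

/-! ### Transport of the stalk hypotheses along an open immersion -/

section Transport

variable {Y' Y : Scheme.{0}} (ι : Y' ⟶ Y) [IsOpenImmersion ι] (η' : Y')

/-- The local ring of an open subscheme at `η′` is regular if the local ring of the ambient scheme at `ι η′` is (the stalk
map of an open immersion is an isomorphism). [cite: BierstoneGrigorievMilmanWlodarczyk2011, Lemma 8.0.3 (2)] -/
theorem isRegularLocalRing_stalk_of_isOpenImmersion (h : IsRegularLocalRing (Y.presheaf.stalk (ι η'))) :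
    IsRegularLocalRing (Y'.presheaf.stalk η') :=
  IsRegularLocalRing.of_ringEquiv (asIso (ι.stalkMap η')).commRingCatIsoToRingEquiv

/-- Krull dimension of the local ring of an open subscheme. [cite: BierstoneGrigorievMilmanWlodarczyk2011, Lemma 8.0.3 (2)] -/
theorem ringKrullDim_stalk_of_isOpenImmersion :
    ringKrullDim (Y'.presheaf.stalk η') = ringKrullDim (Y.presheaf.stalk (ι η')) :=
  (ringKrullDim_eq_of_ringEquiv (asIso (ι.stalkMap η')).commRingCatIsoToRingEquiv).symm

/-- The stalk of the restricted ideal sheaf is the image of the stalk under the stalk isomorphism (tree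
`stalkIdeal_comap_eq_map_stalkMap`, restated with the ring isomorphism). [cite: BierstoneGrigorievMilmanWlodarczyk2011, Lemma 8.0.3 (2)] -/
theorem stalkIdeal_comap_eq_map_ringEquiv (X : Y.IdealSheafData) :
    stalkIdeal (X.comap ι) η' =
      (stalkIdeal X (ι η')).map ((asIso (ι.stalkMap η')).commRingCatIsoToRingEquiv :
        Y.presheaf.stalk (ι η') →+* Y'.presheaf.stalk η') :=
  stalkIdeal_comap_eq_map_stalkMap ι X η'

/-- A principal stalk restricts to a principal stalk. [folklore] -/
theorem isPrincipal_stalkIdeal_comap (X : Y.IdealSheafData) (h : (stalkIdeal X (ι η')).IsPrincipal) :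
    (stalkIdeal (X.comap ι) η').IsPrincipal := by
  obtain ⟨g, hg⟩ := h
  refine ⟨⟨(asIso (ι.stalkMap η')).commRingCatIsoToRingEquiv g, ?_⟩⟩
  rw [stalkIdeal_comap_eq_map_ringEquiv, hg, Ideal.submodule_span_eq, Ideal.map_span, Set.image_singleton,
    Ideal.submodule_span_eq]
  rfl

/-- A non-zero stalk restricts to a non-zero stalk. [folklore] -/
theorem stalkIdeal_comap_ne_bot (X : Y.IdealSheafData) (h : stalkIdeal X (ι η') ≠ ⊥) :
    stalkIdeal (X.comap ι) η' ≠ ⊥ := by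
  rw [stalkIdeal_comap_eq_map_ringEquiv]
  intro hbot
  exact h ((Ideal.map_eq_bot_iff_of_injective
    (asIso (ι.stalkMap η')).commRingCatIsoToRingEquiv.injective).mp hbot)

/-- «`X_η` is not `(y^ν)` for a regular parameter `y`» restricts along an open immersion. [folklore] -/
theorem stalkIdeal_comap_ne_span_pow (X : Y.IdealSheafData)
    (h : ∀ y : Y.presheaf.stalk (ι η'), y ∈ maximalIdeal (Y.presheaf.stalk (ι η')) →
      y ∉ maximalIdeal (Y.presheaf.stalk (ι η')) ^ 2 → ∀ ν : ℕ, stalkIdeal X (ι η') ≠ Ideal.span {y ^ ν}) :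
    ∀ y' : Y'.presheaf.stalk η', y' ∈ maximalIdeal (Y'.presheaf.stalk η') →
      y' ∉ maximalIdeal (Y'.presheaf.stalk η') ^ 2 → ∀ ν : ℕ, stalkIdeal (X.comap ι) η' ≠ Ideal.span {y' ^ ν} := by
  set e : Y.presheaf.stalk (ι η') ≃+* Y'.presheaf.stalk η' := (asIso (ι.stalkMap η')).commRingCatIsoToRingEquiv with he
  have hmax : (maximalIdeal (Y.presheaf.stalk (ι η'))).map (e : Y.presheaf.stalk (ι η') →+* Y'.presheaf.stalk η') =
      maximalIdeal (Y'.presheaf.stalk η') :=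
    IsLocalRing.map_maximalIdeal_of_surjective _ e.surjective
  intro y' hy' hy'2 ν hEq
  obtain ⟨y, rfl⟩ := e.surjective y'
  have hy : y ∈ maximalIdeal (Y.presheaf.stalk (ι η')) := by
    have h1 : e y ∈ (maximalIdeal (Y.presheaf.stalk (ι η'))).map
        (e : Y.presheaf.stalk (ι η') →+* Y'.presheaf.stalk η') := by rw [hmax]; exact hy'
    rw [Ideal.map_comap_of_equiv, Ideal.mem_comap] at h1
    simpa using h1
  have hy2 : y ∉ maximalIdeal (Y.presheaf.stalk (ι η')) ^ 2 := by
    intro h2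
    apply hy'2
    rw [← hmax, ← Ideal.map_pow]
    exact Ideal.mem_map_of_mem _ h2
  apply h y hy hy2 ν
  have h3 : (stalkIdeal X (ι η')).map (e : Y.presheaf.stalk (ι η') →+* Y'.presheaf.stalk η') =
      (Ideal.span {y ^ ν}).map (e : Y.presheaf.stalk (ι η') →+* Y'.presheaf.stalk η') := by
    rw [← stalkIdeal_comap_eq_map_ringEquiv, hEq, Ideal.map_span, Set.image_singleton, RingHom.coe_coe, map_pow]
  have h4 := congrArg (Ideal.map (e.symm : Y'.presheaf.stalk η' →+* Y.presheaf.stalk (ι η'))) h3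
  simpa only [Ideal.map_of_equiv] using h4

end Transport

/-! ### The wrapper -/

/-- **(o25-γ3-T) `V := ⊤` wrapper.**  If for EVERY `(k, Y, f, X, η)` satisfying the hypotheses of
`AbramovichQuekSchober2025_heightTwoCentre` the centre package exists ON `Y` ITSELF — a Rees algebra `R` on `Y`, an affine
`U ∋ η` with a weighted chart `(u; w)` of `R`, the lex-maximal admissible weighted centre germ at `η` on the germs of `u` with
`ℓ / w 0 = ord_η X`, support `closure {η}`, and the order drop at every point of `B₊(U)` over `η` — then the named fact holds:
take `V := ⊤` and apply the package to the open subscheme `⊤ ↪ Y` (the output is literally the fact's witness; the hypotheses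
move along the stalk isomorphism, the two ideal orders by `idealOrder_comap_of_isOpenImmersion`).
[cite: AbramovichQuekSchober2025, Thm 1.3 (1)(3), §4] [cite: BierstoneGrigorievMilmanWlodarczyk2011, Lemma 8.0.3 (2)] -/
theorem heightTwoCentre_of_onScheme
    (H : ∀ (k : Type) [Field k] (Y : Scheme.{0}) (f : Y ⟶ Spec (.of k)) [LocallyOfFiniteType f]
      (X : Y.IdealSheafData) (η : Y),
      IsRegularLocalRing (Y.presheaf.stalk η) →
      ringKrullDim (Y.presheaf.stalk η) = ((2 : ℕ) : WithBot ℕ∞) →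
      (stalkIdeal X η).IsPrincipal → stalkIdeal X η ≠ ⊥ →
      (∀ y : Y.presheaf.stalk η, y ∈ maximalIdeal (Y.presheaf.stalk η) →
        y ∉ maximalIdeal (Y.presheaf.stalk η) ^ 2 → ∀ ν : ℕ, stalkIdeal X η ≠ Ideal.span {y ^ ν}) →
      ∃ (R : ReesAlgebraData Y) (U : Y.affineOpens) (hηU : η ∈ (U : Y.Opens)) (u : Fin 2 → Γ(Y, U))
        (w : Fin 2 → ℕ) (ℓ : ℕ),
        R.IsWeightedChart U u w ∧
        IsLexMaxWeightedCentreGerm (Y.presheaf.stalk η) (stalkIdeal X η)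
          (fun i => (Y.presheaf.germ (U : Y.Opens) η hηU).hom (u i)) w ℓ ∧
        (((ℓ / w 0 : ℕ) : ℕ∞) = idealOrder X η) ∧
        (R.support = closure {η}) ∧
        ∀ b : R.cobordantPlus U, R.cobordantPlusι U b = η →
          idealOrder (R.cobordantStrictTransform U X) b < idealOrder X η) :
    AbramovichQuekSchober2025_heightTwoCentre := by
  intro k _ Y f _ X η hreg hdim hprinc hne hny
  -- the top open subscheme and its point over `η`
  have hηV : η ∈ (⊤ : Y.Opens) := trivial
  have hι : (⊤ : Y.Opens).ι (⟨η, hηV⟩ : (⊤ : Y.Opens)) = η := rfl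
  -- the five hypotheses on `⊤`
  have hreg' : IsRegularLocalRing (((⊤ : Y.Opens) : Scheme.{0}).presheaf.stalk ⟨η, hηV⟩) :=
    isRegularLocalRing_stalk_of_isOpenImmersion (⊤ : Y.Opens).ι ⟨η, hηV⟩ hreg
  have hdim' : ringKrullDim (((⊤ : Y.Opens) : Scheme.{0}).presheaf.stalk ⟨η, hηV⟩) = ((2 : ℕ) : WithBot ℕ∞) := by
    rw [ringKrullDim_stalk_of_isOpenImmersion (⊤ : Y.Opens).ι ⟨η, hηV⟩]
    exact hdim
  have hprinc' : (stalkIdeal (X.comap (⊤ : Y.Opens).ι) ⟨η, hηV⟩).IsPrincipal :=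
    isPrincipal_stalkIdeal_comap (⊤ : Y.Opens).ι ⟨η, hηV⟩ X hprinc
  have hne' : stalkIdeal (X.comap (⊤ : Y.Opens).ι) ⟨η, hηV⟩ ≠ ⊥ :=
    stalkIdeal_comap_ne_bot (⊤ : Y.Opens).ι ⟨η, hηV⟩ X hne
  have hny' := stalkIdeal_comap_ne_span_pow (⊤ : Y.Opens).ι ⟨η, hηV⟩ X hny
  -- the package on `⊤`
  obtain ⟨R, U, hηU, u, w, ℓ, hchart, hlex, hord, hsupp, hdrop⟩ :=
    H k ((⊤ : Y.Opens) : Scheme.{0}) ((⊤ : Y.Opens).ι ≫ f) (X.comap (⊤ : Y.Opens).ι) ⟨η, hηV⟩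
      hreg' hdim' hprinc' hne' hny'
  refine ⟨⊤, hηV, R, U, hηU, u, w, ℓ, hchart, hlex, ?_, hsupp, fun b hb => ?_⟩
  · rw [hord, idealOrder_comap_of_isOpenImmersion, hι]
  · have h := hdrop b hb
    rwa [idealOrder_comap_of_isOpenImmersion (⊤ : Y.Opens).ι X] at h

end AQSHeightTwo

end Summit.ResolutionOfSingularities.ResolutionOfSingularities.Theorems

end
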